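import Literature.Topology.FourManifolds.TrisectionsProductStructure

/-!
# Stub `stub_seamFlow` of line `lp-by-sphere-system-surgery` for crux `AgkCor6Sufficiency`, part 3:
# unit-speed vector fields by partition of unity, and flow boxes
(item stmt-SmoothPoincare4-10894; lead reshape r5, SF; registered helper stub `stub_seamFlowBoxToolkit`)

Milnor's device from the proof of the h-cobordism theorem's Thm. 3.4 on a closed `4`-manifold `X`:
* `exists_local_unit_field` — near a regular point of `G` a smooth local field `s` with `dG(s) = 1`;
* `exists_field_eq_and_unit` — a GLOBAL smooth field `ζ` equal to a prescribed smooth field `ζ₀`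
  on a closed set `A` and with `dG(ζ) = 1` on a closed set `K` on which `G` is regular (the
  constraints are convex: Mathlib's `exists_contMDiffSection_forall_mem_convex_of_local`);
* `hasDerivAt_comp_of_hasMFDerivAt` — chain rule along a curve with a manifold derivative;
* `flow_unit_speed` — the clock: `G (φ_t x) = G x + t` as long as the flow line stays where
  `dG(ζ) = 1` (mean value theorem);
* `exists_time_of_compact` — flow boxes: a continuous `g (x, t)` with `g (x, 0) ∈ W` (open) for `x`
  in a compact set keeps `g (x, t) ∈ W` for `|t| ≤ δ` (tube lemma).

References: Milnor, *Lectures on the h-cobordism theorem* (1965), Lemma 3.2 and proof of Thm. 3.4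
[MilnorHCobordism1965]; Lee, *Introduction to Smooth Manifolds* (2012), Thm. 9.12 [LeeSmoothManifolds2013].
-/

noncomputable section

set_option linter.dupNamespace false

namespace Summit.SmoothPoincare4.SmoothPoincare4.Cruxes.AgkCor6Sufficiency.LpBySphereSystemSurgery

open Set Function Filter
open scoped _root_.Manifold _root_.ContDiff _root_.Topology
open Literature.Topology.FourManifolds

section Fields

variable {X : Type} [TopologicalSpace X] [T2Space X] [CompactSpace X]
  [ChartedSpace (EuclideanSpace ℝ (Fin 4)) X] [IsManifold (𝓡 4) ∞ X]

omit [T2Space X] [CompactSpace X] in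
/-- **A local unit-speed field near a regular point**: if `dG_{x₀} ≠ 0` there is a smooth local
vector field `s` near `x₀` with `dG(s) = 1` (a local field through a vector `v` with `dG(v) ≠ 0`,
normalised by the smooth nonvanishing function `dG(s)`). -/
theorem exists_local_unit_field {G : X → ℝ} (hG : ContMDiff (𝓡 4) 𝓘(ℝ, ℝ) ∞ G) {x₀ : X}
    (hx₀ : mfderiv (𝓡 4) 𝓘(ℝ, ℝ) G x₀ ≠ 0) :
    ∃ Uo ∈ 𝓝 x₀, ∃ s : Π x : X, TangentSpace (𝓡 4) x,
      ContMDiffOn (𝓡 4) (𝓡 4).tangent ∞ (fun x => (⟨x, s x⟩ : TangentBundle (𝓡 4) X)) Uo ∧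
      ∀ y ∈ Uo, mlineDeriv (𝓡 4) G y (s y) = 1 := by
  obtain ⟨v₀, hv₀⟩ := exists_mlineDeriv_ne_zero hx₀
  obtain ⟨O₁, s, hO₁, hx₀O₁, hsx₀, hs⟩ := exists_contMDiffOn_section_eq (I := 𝓡 4) x₀ v₀
  set g : X → ℝ := fun y => mlineDeriv (𝓡 4) G y (s y) with hg
  have hgs : ContMDiffOn (𝓡 4) 𝓘(ℝ, ℝ) ∞ g O₁ := contMDiffOn_mlineDeriv_section hG hs
  set Uo : Set X := O₁ ∩ g ⁻¹' {0}ᶜ with hUo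
  have hUoo : IsOpen Uo := hgs.continuousOn.isOpen_inter_preimage hO₁ isOpen_compl_singleton
  have hx₀U : x₀ ∈ Uo := ⟨hx₀O₁, by show g x₀ ∈ ({0} : Set ℝ)ᶜ; simp only [hg, hsx₀]; exact hv₀⟩
  refine ⟨Uo, hUoo.mem_nhds hx₀U, fun y => (g y)⁻¹ • s y, ?_, fun y hy => ?_⟩
  · exact ((hgs.mono inter_subset_left).inv₀ fun y hy => hy.2).smul_section (hs.mono inter_subset_left)
  · show mlineDeriv (𝓡 4) G y ((g y)⁻¹ • s y) = 1
    rw [mlineDeriv_smul]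
    exact inv_mul_cancel₀ hy.2

/-- **A global field, prescribed on a closed set and of unit speed on another** (partition of
unity for convex constraints).  Let `G` be smooth, `A, K` closed, `B ⊇ A` open, `ζ₀` a field smooth
on `B` with `dG(ζ₀) = 1` on `B ∩ K`, and `G` regular on `K`.  Then some smooth global field `ζ`
has `ζ = ζ₀` on `A` and `dG(ζ) = 1` on `K`. -/
theorem exists_field_eq_and_unit {G : X → ℝ} (hG : ContMDiff (𝓡 4) 𝓘(ℝ, ℝ) ∞ G)
    {A K B : Set X} (hA : IsClosed A) (hK : IsClosed K) (hB : IsOpen B) (hAB : A ⊆ B)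
    {ζ₀ : Π x : X, TangentSpace (𝓡 4) x}
    (hζ₀ : ContMDiffOn (𝓡 4) (𝓡 4).tangent ∞ (fun x => (⟨x, ζ₀ x⟩ : TangentBundle (𝓡 4) X)) B)
    (hunit : ∀ y ∈ B, y ∈ K → mlineDeriv (𝓡 4) G y (ζ₀ y) = 1)
    (hreg : ∀ y ∈ K, mfderiv (𝓡 4) 𝓘(ℝ, ℝ) G y ≠ 0) :
    ∃ ζ : Cₛ^∞⟮𝓡 4; EuclideanSpace ℝ (Fin 4), (TangentSpace (𝓡 4) : X → Type _)⟯,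
      (∀ y ∈ A, ζ y = ζ₀ y) ∧ ∀ y ∈ K, mlineDeriv (𝓡 4) G y (ζ y) = 1 := by
  set t : ∀ y : X, Set (TangentSpace (𝓡 4) y) := fun y =>
    {w | (y ∈ A → w = ζ₀ y) ∧ (y ∈ K → mlineDeriv (𝓡 4) G y w = 1)} with ht
  have hconv : ∀ y : X, Convex ℝ (t y) := by
    intro y w hw w' hw' p q _ _ hpq
    refine ⟨fun hyA => ?_, fun hyK => ?_⟩
    · rw [hw.1 hyA, hw'.1 hyA, ← add_smul, hpq, one_smul]
    · rw [mlineDeriv_add, mlineDeriv_smul, mlineDeriv_smul, hw.2 hyK, hw'.2 hyK, mul_one, mul_one, hpq]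
  obtain ⟨ζ, hζ⟩ : ∃ ζ : Cₛ^∞⟮𝓡 4; EuclideanSpace ℝ (Fin 4), (TangentSpace (𝓡 4) : X → Type _)⟯,
      ∀ y, ζ y ∈ t y := by
    refine exists_contMDiffSection_forall_mem_convex_of_local (𝓡 4)
      (TangentSpace (𝓡 4) : X → Type _) t hconv (fun x₀ => ?_)
    by_cases hxA : x₀ ∈ A
    · exact ⟨B, hB.mem_nhds (hAB hxA), ζ₀, hζ₀, fun y hy => ⟨fun _ => rfl, fun hyK => hunit y hy hyK⟩⟩
    by_cases hxK : x₀ ∈ K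
    · obtain ⟨Uo, hUo, s, hs, hs1⟩ := exists_local_unit_field hG (hreg x₀ hxK)
      refine ⟨Uo ∩ Aᶜ, Filter.inter_mem hUo (hA.isOpen_compl.mem_nhds hxA), s,
        hs.mono inter_subset_left, fun y hy => ⟨fun hyA => absurd hyA hy.2, fun _ => hs1 y hy.1⟩⟩
    · refine ⟨(A ∪ K)ᶜ, (hA.union hK).isOpen_compl.mem_nhds (fun h => h.elim hxA hxK), fun _ => 0,
        (Bundle.contMDiff_zeroSection ℝ (TangentSpace (𝓡 4) : X → Type _)).contMDiffOn,
        fun y hy => ⟨fun hyA => absurd (Or.inl hyA) hy, fun hyK => absurd (Or.inr hyK) hy⟩⟩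
  exact ⟨ζ, fun y hy => (hζ y).1 hy, fun y hy => (hζ y).2 hy⟩

omit [T2Space X] [CompactSpace X] [IsManifold (𝓡 4) ∞ X] in
/-- Chain rule along a curve with a manifold derivative (one-time version of
`hasDerivAt_comp_integralCurve`). -/
theorem hasDerivAt_comp_of_hasMFDerivAt {G : X → ℝ} (hG : ContMDiff (𝓡 4) 𝓘(ℝ, ℝ) ∞ G)
    {γ : ℝ → X} {t : ℝ} {w : TangentSpace (𝓡 4) (γ t)}
    (hγ : HasMFDerivAt 𝓘(ℝ, ℝ) (𝓡 4) γ t ((1 : ℝ →L[ℝ] ℝ).smulRight w)) :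
    HasDerivAt (G ∘ γ) (mlineDeriv (𝓡 4) G (γ t) w) t := by
  -- adapted from `Literature.Topology.FourManifolds.hasDerivAt_comp_integralCurve`
  have h1 : HasMFDerivAt 𝓘(ℝ, ℝ) 𝓘(ℝ, ℝ) (G ∘ γ) t
      ((mfderiv (𝓡 4) 𝓘(ℝ, ℝ) G (γ t)).comp ((1 : ℝ →L[ℝ] ℝ).smulRight w)) :=
    ((hG.mdifferentiableAt (by simp)).hasMFDerivAt).comp t hγ
  have h2 : HasFDerivAt (G ∘ γ)
      ((mfderiv (𝓡 4) 𝓘(ℝ, ℝ) G (γ t)).comp ((1 : ℝ →L[ℝ] ℝ).smulRight w)) t :=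
    hasMFDerivAt_iff_hasFDerivAt.1 h1
  have h3 : ((mfderiv (𝓡 4) 𝓘(ℝ, ℝ) G (γ t)).comp ((1 : ℝ →L[ℝ] ℝ).smulRight w) : ℝ →L[ℝ] ℝ) =
      (1 : ℝ →L[ℝ] ℝ).smulRight (mlineDeriv (𝓡 4) G (γ t) w) := by
    apply ContinuousLinearMap.ext_ring
    show (mfderiv (𝓡 4) 𝓘(ℝ, ℝ) G (γ t)) (((1 : ℝ →L[ℝ] ℝ) (1 : ℝ)) • w) =
      ((1 : ℝ →L[ℝ] ℝ) (1 : ℝ)) • mlineDeriv (𝓡 4) G (γ t) w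
    simp [mlineDeriv]
  exact hasDerivAt_iff_hasFDerivAt.2 (h2.congr_fderiv h3)

/-- **The clock**: if `dG(ζ) = 1` along the flow line of `x` for times in `[-T, T]`, then
`G (φ_t x) = G x + t` there (the function `t ↦ G (φ_t x) - t` has zero derivative: mean value
theorem). -/
theorem flow_unit_speed {ζ : Π x : X, TangentSpace (𝓡 4) x}
    (hζ : ContMDiff (𝓡 4) (𝓡 4).tangent ∞ fun x => (⟨x, ζ x⟩ : TangentBundle (𝓡 4) X))
    {G : X → ℝ} (hG : ContMDiff (𝓡 4) 𝓘(ℝ, ℝ) ∞ G) {x : X} {T : ℝ}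
    (hK : ∀ s ∈ Icc (-T) T, mlineDeriv (𝓡 4) G (flow hζ x s) (ζ (flow hζ x s)) = 1)
    {t : ℝ} (ht : t ∈ Icc (-T) T) : G (flow hζ x t) = G x + t := by
  have hd : ∀ s, HasDerivAt (G ∘ flow hζ x)
      (mlineDeriv (𝓡 4) G (flow hζ x s) (ζ (flow hζ x s))) s :=
    hasDerivAt_comp_integralCurve hG (isMIntegralCurve_flow hζ x)
  have hc : Continuous (G ∘ flow hζ x) := hG.continuous.comp (isMIntegralCurve_flow hζ x).continuous
  rcases lt_trichotomy 0 t with h0t | rfl | ht0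
  · obtain ⟨c, hc', hslope⟩ := exists_hasDerivAt_eq_slope (G ∘ flow hζ x) _ h0t hc.continuousOn
      (fun s _ => hd s)
    have h1 : mlineDeriv (𝓡 4) G (flow hζ x c) (ζ (flow hζ x c)) = 1 :=
      hK c ⟨by linarith [hc'.1, hc'.2, ht.2], hc'.2.le.trans ht.2⟩
    rw [h1, eq_div_iff (by linarith), sub_zero] at hslope
    simp only [comp_apply, flow_zero] at hslope
    linarith
  · simp
  · obtain ⟨c, hc', hslope⟩ := exists_hasDerivAt_eq_slope (G ∘ flow hζ x) _ ht0 hc.continuousOn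
      (fun s _ => hd s)
    have h1 : mlineDeriv (𝓡 4) G (flow hζ x c) (ζ (flow hζ x c)) = 1 :=
      hK c ⟨ht.1.trans hc'.1.le, by linarith [hc'.1, hc'.2, ht.1]⟩
    rw [h1, eq_div_iff (by linarith), zero_sub] at hslope
    simp only [comp_apply, flow_zero] at hslope
    linarith

omit [T2Space X] [CompactSpace X] [ChartedSpace (EuclideanSpace ℝ (Fin 4)) X] [IsManifold (𝓡 4) ∞ X] in
/-- **Flow boxes by compactness** (tube lemma): if `g` is continuous on an open `D ⊆ X × ℝ`
containing `C × {0}` for a compact `C`, and `g (x, 0) ∈ W` (open) for `x ∈ C`, then for some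
`δ > 0`, `(x, t) ∈ D` and `g (x, t) ∈ W` for all `x ∈ C`, `|t| ≤ δ`. -/
theorem exists_time_of_compact {Y : Type} [TopologicalSpace Y] {g : X × ℝ → Y} {D : Set (X × ℝ)}
    (hD : IsOpen D) (hg : ContinuousOn g D) {C : Set X} (hC : IsCompact C) {W : Set Y} (hW : IsOpen W)
    (hCD : ∀ x ∈ C, (x, (0 : ℝ)) ∈ D) (h0 : ∀ x ∈ C, g (x, 0) ∈ W) :
    ∃ δ : ℝ, 0 < δ ∧ ∀ x ∈ C, ∀ t : ℝ, |t| ≤ δ → (x, t) ∈ D ∧ g (x, t) ∈ W := by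
  have hP : IsOpen (D ∩ g ⁻¹' W) := hg.isOpen_inter_preimage hD hW
  have hsub : C ×ˢ ({0} : Set ℝ) ⊆ D ∩ g ⁻¹' W := by
    rintro ⟨x, t⟩ ⟨hx, ht⟩
    rw [mem_singleton_iff] at ht
    subst ht
    exact ⟨hCD x hx, h0 x hx⟩
  obtain ⟨U₁, V, -, hVo, hCU, h0V, hUV⟩ := generalized_tube_lemma hC isCompact_singleton hP hsub
  obtain ⟨ε, hε, hεV⟩ := Metric.isOpen_iff.1 hVo 0 (h0V (mem_singleton _))
  refine ⟨ε / 2, by positivity, fun x hx t ht => ?_⟩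
  have htV : t ∈ V := hεV (by rw [Metric.mem_ball, Real.dist_eq, sub_zero]; linarith [abs_nonneg t])
  exact hUV (mk_mem_prod (hCU hx) htV)

end Fields

/-! ## The registered helper stub -/

/-- **The flow-box toolkit** (registered helper stub `stub_seamFlowBoxToolkit` of `stub_seamFlow`)
on a closed `4`-manifold: global smooth fields prescribed on a closed set and of unit speed for `G`
on another; the clock along the flow; flow boxes by compactness; the chain rule along a curve. -/
def SeamFlowBoxToolkit : Prop :=
  ∀ (X : Type) [TopologicalSpace X] [T2Space X] [CompactSpace X] [ChartedSpace (EuclideanSpace ℝ (Fin 4)) X]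
    [IsManifold (𝓡 4) ∞ X],
    (∀ (G : X → ℝ), ContMDiff (𝓡 4) 𝓘(ℝ, ℝ) ∞ G → ∀ (A K B : Set X), IsClosed A → IsClosed K →
      IsOpen B → A ⊆ B → ∀ ζ₀ : Π x : X, TangentSpace (𝓡 4) x,
      ContMDiffOn (𝓡 4) (𝓡 4).tangent ∞ (fun x => (⟨x, ζ₀ x⟩ : TangentBundle (𝓡 4) X)) B →
      (∀ y ∈ B, y ∈ K → mlineDeriv (𝓡 4) G y (ζ₀ y) = 1) →
      (∀ y ∈ K, mfderiv (𝓡 4) 𝓘(ℝ, ℝ) G y ≠ 0) →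
      ∃ ζ : Cₛ^∞⟮𝓡 4; EuclideanSpace ℝ (Fin 4), (TangentSpace (𝓡 4) : X → Type _)⟯,
        (∀ y ∈ A, ζ y = ζ₀ y) ∧ ∀ y ∈ K, mlineDeriv (𝓡 4) G y (ζ y) = 1) ∧
    (∀ (ζ : Π x : X, TangentSpace (𝓡 4) x)
      (hζ : ContMDiff (𝓡 4) (𝓡 4).tangent ∞ fun x => (⟨x, ζ x⟩ : TangentBundle (𝓡 4) X))
      (G : X → ℝ), ContMDiff (𝓡 4) 𝓘(ℝ, ℝ) ∞ G → ∀ (x : X) (T : ℝ),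
      (∀ s ∈ Icc (-T) T, mlineDeriv (𝓡 4) G (flow hζ x s) (ζ (flow hζ x s)) = 1) →
      ∀ t ∈ Icc (-T) T, G (flow hζ x t) = G x + t) ∧
    (∀ (g : X × ℝ → X) (D : Set (X × ℝ)), IsOpen D → ContinuousOn g D → ∀ C : Set X, IsCompact C →
      ∀ W : Set X, IsOpen W → (∀ x ∈ C, (x, (0 : ℝ)) ∈ D) → (∀ x ∈ C, g (x, 0) ∈ W) →
      ∃ δ : ℝ, 0 < δ ∧ ∀ x ∈ C, ∀ t : ℝ, |t| ≤ δ → (x, t) ∈ D ∧ g (x, t) ∈ W) ∧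
    (∀ (G : X → ℝ), ContMDiff (𝓡 4) 𝓘(ℝ, ℝ) ∞ G → ∀ (γ : ℝ → X) (t : ℝ) (w : TangentSpace (𝓡 4) (γ t)),
      HasMFDerivAt 𝓘(ℝ, ℝ) (𝓡 4) γ t ((1 : ℝ →L[ℝ] ℝ).smulRight w) →
      HasDerivAt (G ∘ γ) (mlineDeriv (𝓡 4) G (γ t) w) t)

/-- **Registered helper stub `stub_seamFlowBoxToolkit`.** -/
theorem stub_seamFlowBoxToolkit : SeamFlowBoxToolkit := fun _ _ _ _ _ _ =>
  ⟨fun _ hG _ _ _ hA hK hB hAB _ hζ₀ hunit hreg => exists_field_eq_and_unit hG hA hK hB hAB hζ₀ hunit hreg,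
    fun _ hζ _ hG _ _ hK _ ht => flow_unit_speed hζ hG hK ht,
    fun _ _ hD hg _ hC _ hW hCD h0 => exists_time_of_compact hD hg hC hW hCD h0,
    fun _ hG _ _ _ hγ => hasDerivAt_comp_of_hasMFDerivAt hG hγ⟩

end Summit.SmoothPoincare4.SmoothPoincare4.Cruxes.AgkCor6Sufficiency.LpBySphereSystemSurgery

end
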